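import Summits.AtomisticToContinuum.BoseEinsteinCondensation.Theses.BECStronglyRayleigh
import Summits.AtomisticToContinuum.BoseEinsteinCondensation.Theses.BECLiebAntibunching
import Summits.AtomisticToContinuum.BoseEinsteinCondensation.Theses.BECCountConvexity
import Summits.AtomisticToContinuum.BoseEinsteinCondensation.Theorems.LatticeToPeriodicBridge.Negative.WindowedBridge

/-!
# Route `BECStronglyRayleigh`, crux `LatticeToPeriodicBridge` (stmt-AtomisticToContinuum-9674),
# line `coarse-cell-lorentzian` — vocabulary and registered stub statements

This is the `Defs` file of the crux line `coarse-cell-lorentzian`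
(`Summits/AtomisticToContinuum/BoseEinsteinCondensation/Cruxes/LatticeToPeriodicBridge/Lines/coarse-cell-lorentzian.{md,lean}`,
idea card `…/Ideas/coarse-cell-lorentzian.md`, triage r1-1/2/3: pass; lead's reshape of S6, 2026-08-16). It holds, verbatim
from the registered skeleton (`ledger skeleton check`, sha 9141234f… and successors) and in the skeleton's namespace so that the
registered stub signatures `Sig.stub_<name>` resolve BY NAME in the stub files
`Theorems/BECStronglyRayleighLatticeToPeriodicBridge<Stub>.lean` (landed `--supports stmt-AtomisticToContinuum-9674`):

* the objects the line posits (data only — sets and real numbers): the cubic cells `torusCell` of the thermodynamic torus,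
  the tagged-pair configuration `pairConfig ξ η X' = Fin.cons ξ (Fin.cons η X')`, the conditional CELL-PAIR KERNEL
  `cellKernel` (`K_{X'}(x,y) = ∫_{C_x}∫_{C_y} Re Ψ(ξ,η,X')`), the cell pair-insertion field `cellField` (`r_{X'}(x) = Σ_y K`),
  and the three background-integrated functionals `kernelMass` (`I_K = ∫‖K_{X'}‖_F²`), `fieldMoment`
  (`I_F = ∫[Σr³/R + ‖r‖⁴/R²]`), `fieldMass` (`I_r = ∫‖r‖²`);
* the predicate `PeriodicBECAt v` = the consequent of the crux at one potential (definitionally the landed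
  `Theorems.LatticeToPeriodicBridge.Negative.ConsequentAt`, `periodicBECAt_iff`);
* the STATEMENTS of the six planner-registered stubs (`Sig.stub_diluteEnergyCeiling`, `Sig.stub_cellNormRetention`,
  `Sig.stub_cellPairSumRule`, `Sig.stub_integratedPairCoherence`, `Sig.stub_cellInsertionDelocalisation`,
  `Sig.stub_positiveTransfer`) and of the lead's merged open stub `Sig.stub_pairKernelRowFlatness` (⟸ S4 ∧ S5, glue
  `Sig.stub_pairKernelRowFlatness_of`; it is all the composition consumes of S4/S5) as named, deliberately untagged `Prop`s — intermediate statements of a proof plan, not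
  results in print (the audit's advisory `vendored-fact` class for witness-less `def : Prop` is expected until the stub files
  provide the witnesses). `Sig.stub_integratedPairCoherence` (the lever) and `Sig.stub_cellInsertionDelocalisation` (hardest)
  are the line's open content; `Sig.stub_positiveTransfer` takes the sub-problem's fixed-`N` route items `PeriodicRigidity`
  (stmt-AtomisticToContinuum-9467, namespace `BECLiebAntibunching`, weakest typed form `∀η ∀ᶠN ∃δ`) and
  `PositivePeriodicNearMinimiser` (stmt-AtomisticToContinuum-14006, namespace `BECCountConvexity`) BY NAME as antecedents;
* two finite-dimensional sanity lemmas on the normalisation of the two open stubs (`moment_le_two_mul_mass`: S5 is trivial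
  at fixed `M` with `𝕄 = 2M³`; `flatKernel_halfSlack`: the flat kernel sits at `I_K = I_F/2`, the factor-2 slack of S4).

The sorry-free composition `periodicBEC_of` / `LatticeToPeriodicBridge_of` (six stubs + the two named items ⇒ the crux by
name) stays in the skeleton `Lines/coarse-cell-lorentzian.lean` until the last stub lands. References: LSSY 2005 Thm 2.2,
App. C; Fournais 2020 (1.1)–(1.5); Brändén–Huh 2019 Prop 1.2 / Lemma 1.5; Payne–Weinberger 1960; Penrose–Onsager 1956.
-/

noncomputable section

open MeasureTheory Filter
open scoped ENNReal Topology

namespace Summit.AtomisticToContinuum.BoseEinsteinCondensation.Cruxes.LatticeToPeriodicBridge.CoarseCellLorentzian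

open Literature.MathematicalPhysics.QuantumManyBody.BoseGas
open Literature.Barriers.AtomisticToContinuum.BoseGas
open Summit.AtomisticToContinuum.BoseEinsteinCondensation.Theses
open Summit.AtomisticToContinuum.BoseEinsteinCondensation.Theses.BECStronglyRayleigh

/-! ## Vocabulary (data: sets and real numbers; no `Prop` is hidden in a definition) -/

/-- The cubic cell `∏_k [x_k b, (x_k+1) b)` of side `b` with integer corner `x ∈ (Fin M)³`; for `b = L/M` the
`M³` cells tile the fundamental cell `[0,L)³` of the torus exactly. [folklore] -/
def torusCell (M : ℕ) (b : ℝ) (x : Fin 3 → Fin M) : Set Space :=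
  {ξ | ∀ k, ξ k ∈ Set.Ico (((x k : ℕ) : ℝ) * b) ((((x k : ℕ) : ℝ) + 1) * b)}

/-- The configuration `(ξ, η, X')` of `N' + 2` particles: tagged pair `(ξ, η)` in slots `0, 1`, background `X'`. [folklore] -/
def pairConfig {N' : ℕ} (ξ η : Space) (X' : Config N') : Config (N' + 2) :=
  Fin.cons ξ (Fin.cons η X')

/-- **Conditional cell-pair kernel** `K_{X'}(x,y) = ∫_{ξ ∈ C_x} ∫_{η ∈ C_y} Re Ψ(ξ, η, X') dη dξ` of an
`(N'+2)`-body wave function on the torus of side `L` cut into `M³` cells of side `L/M`, at background `X'`. [folklore] -/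
def cellKernel {N' : ℕ} (L : ℝ) (M : ℕ) (Ψ : Config (N' + 2) → ℂ) (X' : Config N')
    (x y : Fin 3 → Fin M) : ℝ :=
  ∫ ξ in torusCell M (L / M) x, ∫ η in torusCell M (L / M) y, (Ψ (pairConfig ξ η X')).re

/-- **Cell pair-insertion field** `r_{X'}(x) = Σ_y K_{X'}(x,y)`. [folklore] -/
def cellField {N' : ℕ} (L : ℝ) (M : ℕ) (Ψ : Config (N' + 2) → ℂ) (X' : Config N')
    (x : Fin 3 → Fin M) : ℝ :=
  ∑ y, cellKernel L M Ψ X' x y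

/-- `I_K = ∫_{cell^{N'}} ‖K_{X'}‖_F² dX'` (background-integrated Frobenius mass of the kernels). [folklore] -/
def kernelMass {N' : ℕ} (L : ℝ) (M : ℕ) (Ψ : Config (N' + 2) → ℂ) : ℝ :=
  ∫ X' in cellN N' L, ∑ x, ∑ y, cellKernel L M Ψ X' x y ^ 2

/-- `I_F = ∫_{cell^{N'}} [Σ_x r_{X'}(x)³ / R_{X'} + ‖r_{X'}‖⁴ / R_{X'}²] dX'` (the rank-one-dominance majorant;
Lean's `x / 0 = 0` matches `K_{X'} = 0`). [folklore] -/
def fieldMoment {N' : ℕ} (L : ℝ) (M : ℕ) (Ψ : Config (N' + 2) → ℂ) : ℝ :=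
  ∫ X' in cellN N' L,
    ((∑ x, cellField L M Ψ X' x ^ 3) / (∑ x, cellField L M Ψ X' x) +
      (∑ x, cellField L M Ψ X' x ^ 2) ^ 2 / (∑ x, cellField L M Ψ X' x) ^ 2)

/-- `I_r = ∫_{cell^{N'}} ‖r_{X'}‖² dX'`. [folklore] -/
def fieldMass {N' : ℕ} (L : ℝ) (M : ℕ) (Ψ : Config (N' + 2) → ℂ) : ℝ :=
  ∫ X' in cellN N' L, ∑ x, cellField L M Ψ X' x ^ 2

/-- The consequent of the crux at one potential (verbatim the body of stmt-0826 / `Negative.ConsequentAt`). [folklore] -/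
def PeriodicBECAt (v : ℝ → ℝ≥0∞) : Prop :=
  ∃ ρ₀ : ℝ, 0 < ρ₀ ∧ ∀ ρ : ℝ, 0 < ρ → ρ < ρ₀ → ∃ c : ℝ, 0 < c ∧ ∀ᶠ N : ℕ in atTop,
    ∃ δ : ℝ≥0∞, 0 < δ ∧ ∀ Ψ : PeriodicTrialState N (sideLength ρ N),
      periodicEnergy v Ψ ≤ periodicGroundStateEnergy v N (sideLength ρ N) + δ →
        ENNReal.ofReal (c * N) ≤ condensateOccupation N (sideLength ρ N) Ψ.ψ

/-- The crux restated with this vocabulary — DEFINITIONALLY. [folklore] -/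
theorem crux_iff :
    LatticeToPeriodicBridge ↔ (KineticLatticeBEC → ∀ v, IsRepulsiveFiniteRange v → PeriodicBECAt v) :=
  Iff.rfl

/-- … and it is the landed `Negative.ConsequentAt` (so §1/§4/§7 of the Disproof speak about these stubs). [folklore] -/
theorem periodicBECAt_iff (v : ℝ → ℝ≥0∞) :
    PeriodicBECAt v ↔ Theorems.LatticeToPeriodicBridge.Negative.ConsequentAt v :=
  Iff.rfl

/-! ## The six registered stub statements (`Sig.stub_<name>` = the registered signature; deliberately untagged) -/

/-- **S1 — dilute energy ceiling** (size M). For every repulsive finite-range `v` there are `C ≥ 0` and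
`ρ₁ > 0` such that for `0 < ρ < ρ₁`, eventually in `N`, `E₀^per(N, L_N) ≤ C ρ N` (`L_N = (N/ρ)^{1/3}`).
Proof route: `a = scatteringLength v < ∞` (`scatteringLength_ne_top_of_finiteRange`, hard cores included),
`LSSY2005_upperBound_periodic_holds` (PROVED: `E₀ ≤ 4πρ₁'a(1 + C'a/b_ρ)N`, `ρ₁' = (N−1)/L³ ≤ ρ`,
`b_ρ = (4πρ₁'/3)^{-1/3}`) with `a/b_ρ ≤ a(4πρ/3)^{1/3} ≤ c'` for `ρ < 3c'³/(4πa³)` (any `ρ` if `a = 0`),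
`2R₀ < L_N` and `N ≥ 2` eventually; `C = 4πa(1 + C'c')`. The only place energy enters the line
(refs: LSSY 2005 Thm 2.2 (2.14), App. C Remark 2). Stub statement — deliberately untagged. -/
def Sig.stub_diluteEnergyCeiling : Prop :=
  ∀ v : ℝ → ℝ≥0∞, IsRepulsiveFiniteRange v → ∃ C : ℝ, 0 ≤ C ∧ ∃ ρ₁ : ℝ, 0 < ρ₁ ∧
    ∀ ρ : ℝ, 0 < ρ → ρ < ρ₁ → ∀ᶠ N : ℕ in atTop,
      periodicGroundStateEnergy v N (sideLength ρ N) ≤ ENNReal.ofReal (C * ρ * N)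

/-- **S2 — cell norm retention** (size M/L: Poincaré–Wirtinger on a cube is not in Mathlib). For a REAL-valued
periodic trial state `Ψ` of `N'+2` bosons with finite energy and `M ≥ 1` cells per side (`b = L/M`):
`b⁶ (1 − 2b²·E(Ψ)/(N'+2)) ≤ I_K`. Proof route: `Σ_{x,y}K_{X'}(x,y)² = b⁶‖(P⊗P)Ψ(·,·,X')‖²` with `P` the
cell-averaging projection of `L²(cell)`; `1 − P⊗P ≤ (1−P)⊗1 + 1⊗(1−P)`; Poincaré–Wirtinger on each cube
`‖f − f̄_C‖²_{L²(C)} ≤ b²‖∇f‖²_{L²(C)}` (any constant `≤ 1` in front of `b²` will do — the sharp Neumann one is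
`π⁻²`); the kinetic energy of particles `0` and `1` is `2T/(N'+2)` by Bose symmetry and `T ≤ periodicEnergy`;
`‖Ψ‖²_{L²(cell^N)} = 1`, `Re Ψ = Ψ`. Any potential `v` (the interaction is only dropped) (refs: standard;
Payne–Weinberger 1960 for the convex-domain constant). Stub statement — deliberately untagged. -/
def Sig.stub_cellNormRetention : Prop :=
  ∀ (v : ℝ → ℝ≥0∞) (N' : ℕ) (L : ℝ) (M : ℕ), 0 < L → 1 ≤ M →
    ∀ Ψ : PeriodicTrialState (N' + 2) L, (∀ X, (Ψ.ψ X).im = 0) → periodicEnergy v Ψ ≠ ⊤ →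
      (L / M) ^ 6 * (1 - 2 * (L / M) ^ 2 * (periodicEnergy v Ψ).toReal / ((N' : ℝ) + 2)) ≤
        kernelMass L M Ψ.ψ

/-- **S3 — cell pair sum rule, "≥" direction** (size M; the flat-cell dictionary). For every periodic trial
state of `N'+2` bosons and `M ≥ 1`: `(N'+2)·M⁻³·b⁻⁶·I_r ≤ condensateOccupation` (as `ENNReal.ofReal _ ≤ _`).
Proof route: `condensateOccupation = (N'+2) L⁻³ ∫_{cell^{N'+1}} |∫_cell Ψ(ξ, Y) dξ|² dY` (unfold `occupation`,
`constantMode`, the `cellN` indicator; `Matrix.vecCons = Fin.cons`); `|z|² ≥ (Re z)²`; write `Y = (η, X')` and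
split `∫_cell dη = Σ_y ∫_{C_y}`; Cauchy–Schwarz on each `C_y`: `∫_{C_y} g² ≥ b⁻³(∫_{C_y} g)²` with
`g(η) = ∫_cell Re Ψ(ξ,η,X')dξ`, `∫_{C_y} g = Σ_x K_{X'}(x,y)` (Fubini); Bose symmetry in slots `0,1` gives
`K_{X'}(x,y) = K_{X'}(y,x)`, so column sums are `r_{X'}(y)`; `L⁻³b⁻³ = M⁻³b⁻⁶`. No reality / positivity /
near-minimiser hypothesis (refs: Penrose–Onsager 1956; Fournais 2020 (1.3)–(1.5)). Stub statement — deliberately untagged. -/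
def Sig.stub_cellPairSumRule : Prop :=
  ∀ (N' : ℕ) (L : ℝ) (M : ℕ), 0 < L → 1 ≤ M → ∀ Ψ : PeriodicTrialState (N' + 2) L,
    ENNReal.ofReal (((N' : ℝ) + 2) * ((M : ℝ) ^ 3)⁻¹ * ((L / M) ^ 6)⁻¹ * fieldMass L M Ψ.ψ) ≤
      condensateOccupation (N' + 2) L Ψ.ψ

/-- **S4 — integrated pair coherence, THE LEVER** (open; "Theorem S one scale up", robust integrated form).
For every repulsive finite-range `v` there are a cell scale `b₀ = b₀(v) > 0` (`≍ max(a, R₀)`; hard spheres: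
signature of the `N = 2` kernel holds iff `b/a ≳ 1.72`, three independent computations of the panel) and a density
`ρ_c(v) > 0` such that on every torus of side `L` cut into `M ≥ 2` cells per side of side `b = L/M ≥ b₀`, for
every particle number `N'+2 ≤ ρ_c L³`, some slack `δ > 0` makes every REAL NON-NEGATIVE `δ`-near-minimiser
satisfy `I_K ≤ 2·I_F`. Mechanism: for the exact ground state `Ψ₀` and a.e. background `X'`, the entrywise
non-negative symmetric kernel `K_{X'}` has exactly ONE positive eigenvalue (Lorentz signature) ⟺ reverse
Cauchy–Schwarz `(𝟙ᵀKu)² ≥ (𝟙ᵀK𝟙)(uᵀKu)`; `u = e_x + e_y` and `u = r` give `K(x,y) ≤ (r_x+r_y)²/(2R)`,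
`rᵀKr ≤ ‖r‖⁴/R`, whence `‖K‖_F² ≤ Σr³/R + ‖r‖⁴/R²` pointwise in `X'` (the route's proof of
`StableImpliesPairCoherence`, continuum diagonal included); integrate; the factor 2 is the robustness margin that
carries the inequality from `Ψ₀` to `C¹` near-minimisers (both sides are `L²`-continuous on real non-negative
states, `I_F(Ψ₀) > 0`; rigidity = stub S6's engine), so NO openness of signature and NO `0 < a(v)` is needed in
the statement (Disproof §8a: at `a = 0` the flat kernel has `I_K = I_F/2`). Why signature: `N = 2` —
`K = b⁶(f_∞𝟙𝟙ᵀ − W̄)`, `ŵ(k) = 4πa(k)/k²`, aliases `O((a/b)³)`; Jastrow level, any `N`, any background —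
`K = f_∞UUᵀ − W_F`, `W_F(x,y) = ∫_{C_x}∫_{C_y}F w F` PSD whenever the cell-averaged `w` is (28/28 frozen
backgrounds, TRIAGE-r1-1 gen 2); lattice twins block-Lorentzian on `4³`, `6³` (TRIAGE-r1-3); beyond Jastrow
(three-body correlations at `O((a/b)²)`) CONJECTURAL — no engine yet (bondwise Borcea–Brändén dies off-bond).
Forbids: paired-in-cell kernels (`K = I_n`, `n ≥ 5`) and `≥ 5` macroscopic fragments (`K = ⊕₅J`)
(refs: Brändén–Huh 2019 Prop 1.2 / Lemma 1.5; Borcea–Brändén–Liggett 2007; LSSY 2005 App. C; Fournais 2020 (A.5)).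
OPEN stub statement — deliberately untagged. -/
def Sig.stub_integratedPairCoherence : Prop :=
  ∀ v : ℝ → ℝ≥0∞, IsRepulsiveFiniteRange v → ∃ b₀ : ℝ, 0 < b₀ ∧ ∃ ρc : ℝ, 0 < ρc ∧
    ∀ (L : ℝ) (M : ℕ), 0 < L → 2 ≤ M → b₀ ≤ L / M →
      ∀ N' : ℕ, ((N' : ℝ) + 2) ≤ ρc * L ^ 3 →
        ∃ δ : ℝ≥0∞, 0 < δ ∧ ∀ Ψ : PeriodicTrialState (N' + 2) L,
          (∀ X, 0 ≤ (Ψ.ψ X).re ∧ (Ψ.ψ X).im = 0) →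
          periodicEnergy v Ψ ≤ periodicGroundStateEnergy v (N' + 2) L + δ →
            kernelMass L M Ψ.ψ ≤ 2 * fieldMoment L M Ψ.ψ

/-- **S5 — cell insertion delocalisation, HARDEST** (rank 3 `InsertionFieldDelocalisation` one scale up, with
the background in continuum configuration space; XL, plausibly as hard as the conjunct). For every repulsive
finite-range `v` there are `𝕄 = 𝕄(v) > 0`, a cell scale `b₁(v) > 0` and a density `ρ_d(v) > 0` such that on
every torus cut into `M ≥ 2` cells per side of side `b = L/M ≥ b₁`, for `N'+2 ≤ ρ_d L³`, some `δ > 0` makes every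
real non-negative `δ`-near-minimiser satisfy `M³·I_F ≤ 𝕄·I_r`, i.e. the `ω`-average (`ω_{X'} ∝ ‖r_{X'}‖²`) of
`M³Φ_{X'}`, `Φ = Σr³/(R‖r‖²) + ‖r‖²/R²`, is `≤ 𝕄`. Flat field: `M³Φ = 2` (so `𝕄 ≥ 2`; `v = 0`: `𝕄 = 4` with
the near-minimiser margin); for `r = r̄(1+ε)`, `M³Φ ≈ 2 + 3⟨ε²⟩`: the statement is a bound on the mean-square
RELATIVE fluctuation across cells of the two-particle insertion field `r_{X'} =` cell sums of
`χ_{X'}(ξ) = ∫Ψ(ξ,η,X')dη` — off-diagonal long-range order of the pair-insertion amplitude in all but name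
(infrared-finite in `d = 3` at Bogoliubov level, `Σ_k 1/(Nk) < ∞`; divergent in `d = 1, 2`). Trivially true at
fixed `M` with `𝕄 = 2M³` (`F(r) ≤ 2‖r‖²` for `r ≥ 0`); the content is uniformity as `M = L_N/b → ∞`. Small `N`
at large `L` is harmless (`N' = 0`: `r` exactly flat by translation invariance). Same family as
`BECRieszReverseHolder.CoarseGrainedReverseHolder` at resolution `ℓ = b` (may borrow its Riesz-shadow engine)
(refs: Reatto–Chester 1967; LSSY 2005 Ch. 5; Borcea–Brändén–Liggett 2007 Thm 4.9 (negative association, lattice twin)).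
OPEN stub statement (HARDEST) — deliberately untagged. -/
def Sig.stub_cellInsertionDelocalisation : Prop :=
  ∀ v : ℝ → ℝ≥0∞, IsRepulsiveFiniteRange v → ∃ 𝕄 : ℝ, 0 < 𝕄 ∧ ∃ b₁ : ℝ, 0 < b₁ ∧ ∃ ρd : ℝ, 0 < ρd ∧
    ∀ (L : ℝ) (M : ℕ), 0 < L → 2 ≤ M → b₁ ≤ L / M →
      ∀ N' : ℕ, ((N' : ℝ) + 2) ≤ ρd * L ^ 3 →
        ∃ δ : ℝ≥0∞, 0 < δ ∧ ∀ Ψ : PeriodicTrialState (N' + 2) L,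
          (∀ X, 0 ≤ (Ψ.ψ X).re ∧ (Ψ.ψ X).im = 0) →
          periodicEnergy v Ψ ≤ periodicGroundStateEnergy v (N' + 2) L + δ →
            (M : ℝ) ^ 3 * fieldMoment L M Ψ.ψ ≤ 𝕄 * fieldMass L M Ψ.ψ

/-- **S4∧S5 merged — row flatness of the conditional cell-pair kernels** (lead's reshape after the drefuter's remark that the
composition consumes S4 and S5 only through their product `M³·I_K ≤ 2𝕄·I_r`): for every repulsive finite-range `v` there are
`𝕄 > 0`, a cell scale `b₁ > 0` and a density `ρ_d > 0` such that on every torus cut into `M ≥ 2` cells per side of side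
`b = L/M ≥ b₁`, for `N'+2 ≤ ρ_d L³`, some `δ > 0` makes every REAL NON-NEGATIVE `δ`-near-minimiser satisfy `M³·I_K ≤ 𝕄·I_r`,
i.e. `M³ ∫Σ_{x,y}K_{X'}(x,y)² ≤ 𝕄 ∫Σ_x (Σ_y K_{X'}(x,y))²`: the rows of the conditional cell-pair kernel are flat in `ω`-mean square
(`ω_{X'} ∝ ‖r_{X'}‖²`), uniformly in `M`. Flat kernel: ratio exactly `1` (so `𝕄 ≥ 1`); Cauchy–Schwarz gives `M³ΣK² ≥ Σr²` always,
so the content is the converse up to the constant `𝕄` — delocalisation of the conditional pair amplitude over cells, with NO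
signature / Lorentzian claim. Implied by S4 ∧ S5 with `𝕄 ↦ 2𝕄` (`Sig.stub_pairKernelRowFlatness_of`); trivially true at fixed `M`
(`𝕄 = M³`); its uniformity in `M = L_N/b → ∞` is BEC-strength (a fragmented / crystalline ground state in the admissible density
range would violate it). OPEN stub statement — deliberately untagged. -/
def Sig.stub_pairKernelRowFlatness : Prop :=
  ∀ v : ℝ → ℝ≥0∞, IsRepulsiveFiniteRange v → ∃ 𝕄 : ℝ, 0 < 𝕄 ∧ ∃ b₁ : ℝ, 0 < b₁ ∧ ∃ ρd : ℝ, 0 < ρd ∧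
    ∀ (L : ℝ) (M : ℕ), 0 < L → 2 ≤ M → b₁ ≤ L / M →
      ∀ N' : ℕ, ((N' : ℝ) + 2) ≤ ρd * L ^ 3 →
        ∃ δ : ℝ≥0∞, 0 < δ ∧ ∀ Ψ : PeriodicTrialState (N' + 2) L,
          (∀ X, 0 ≤ (Ψ.ψ X).re ∧ (Ψ.ψ X).im = 0) →
          periodicEnergy v Ψ ≤ periodicGroundStateEnergy v (N' + 2) L + δ →
            (M : ℝ) ^ 3 * kernelMass L M Ψ.ψ ≤ 𝕄 * fieldMass L M Ψ.ψ

/-- **Glue**: the lever (S4) and the delocalisation stub (S5) together give row flatness with constant `2𝕄`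
(`M³ I_K ≤ 2M³ I_F ≤ 2𝕄 I_r`). [folklore] -/
theorem Sig.stub_pairKernelRowFlatness_of (h4 : Sig.stub_integratedPairCoherence)
    (h5 : Sig.stub_cellInsertionDelocalisation) : Sig.stub_pairKernelRowFlatness := by
  intro v hv
  obtain ⟨b₀, hb₀, ρc, hρc, hcoh⟩ := h4 v hv
  obtain ⟨𝕄, h𝕄, b₁, hb₁, ρd, hρd, hdel⟩ := h5 v hv
  refine ⟨2 * 𝕄, by positivity, max b₀ b₁, lt_max_of_lt_left hb₀, min ρc ρd, lt_min hρc hρd, ?_⟩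
  intro L M hL hM hb N' hN'
  have hL3 : (0 : ℝ) ≤ L ^ 3 := by positivity
  obtain ⟨δ₄, hδ₄, h4'⟩ := hcoh L M hL hM ((le_max_left _ _).trans hb) N'
    (hN'.trans (mul_le_mul_of_nonneg_right (min_le_left _ _) hL3))
  obtain ⟨δ₅, hδ₅, h5'⟩ := hdel L M hL hM ((le_max_right _ _).trans hb) N'
    (hN'.trans (mul_le_mul_of_nonneg_right (min_le_right _ _) hL3))
  refine ⟨min δ₄ δ₅, lt_min hδ₄ hδ₅, fun Ψ hpos hE => ?_⟩
  have hC := h4' Ψ hpos (hE.trans (add_le_add le_rfl (min_le_left _ _)))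
  have hD := h5' Ψ hpos (hE.trans (add_le_add le_rfl (min_le_right _ _)))
  have hM3 : (0 : ℝ) ≤ (M : ℝ) ^ 3 := by positivity
  calc (M : ℝ) ^ 3 * kernelMass L M Ψ.ψ ≤ (M : ℝ) ^ 3 * (2 * fieldMoment L M Ψ.ψ) :=
        mul_le_mul_of_nonneg_left hC hM3
    _ = 2 * ((M : ℝ) ^ 3 * fieldMoment L M Ψ.ψ) := by ring
    _ ≤ 2 * (𝕄 * fieldMass L M Ψ.ψ) := mul_le_mul_of_nonneg_left hD (by norm_num)
    _ = 2 * 𝕄 * fieldMass L M Ψ.ψ := by ring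

/-- **S6 — positive transfer** (size M; fixed volume; RESHAPED by the lead 2026-08-16: the two fixed-`N` inputs that are
route items elsewhere in the sub-problem — `PeriodicRigidity` (stmt-AtomisticToContinuum-9467, taken in its weakest typed
form `∀η ∀ᶠN ∃δ`, namespace `BECLiebAntibunching`) and `PositivePeriodicNearMinimiser` (stmt-AtomisticToContinuum-14006,
namespace `BECCountConvexity`) — are taken BY NAME as antecedents, exactly as line `muffin-tin` takes 9677/9678; the
occupation-stability input (stmt-9164) is NOT taken: it is the Literature theorem
`PeriodicTrialState.condensateOccupation_le_add_of_phase_sq_dist_le`). For every repulsive finite-range `v` there is `ρ_r > 0`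
such that for `0 < ρ < ρ_r` and every level `c₁ > 0`, eventually in `N`: if for some slack `δ₁ > 0` EVERY real
non-negative `δ₁`-near-minimiser on the torus of side `L_N` has `n₀ ≥ c₁N`, then for some `δ > 0` EVERY
`δ`-near-minimiser has `n₀ ≥ (c₁/4)N`. Proof route (the BECRieszShadow frame, items shared by 14 routes): take
`ρ_r ≤` the thresholds of `PeriodicRigidity` (stmt-9467: any two `δ_R`-near-minimisers are `η`-close in
`L²(cell^N)` up to a unit phase, `η := c₁/16` fixed before `N`) and of
`exists_eventually_periodicGroundStateEnergy_lt_top` (so `E₀^per < ∞`); `δ := min(δ₁, δ_R)/4`; given a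
`δ`-near-minimiser `Φ`, the state `(√(|Φ|²+ε²) − ε)/‖·‖` is a `C¹`, periodic, symmetric, REAL NON-NEGATIVE
`2δ`-near-minimiser `Ψ` (diamagnetic inequality `|∇√(|Φ|²+ε²)| ≤ |∇Φ|`, `√(|Φ|²+ε²) − ε ≤ |Φ|`, `‖·‖ → 1`),
hence `n₀(Ψ) ≥ c₁N`; `PeriodicOccupationStability` (stmt-9164: `√n₀(Φ) ≥ √n₀(Ψ) − √(Nη)`) gives
`n₀(Φ) ≥ (9/16)c₁N`. Why it might fail: only through `PeriodicRigidity` (hard-core walls disconnecting the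
fixed-`N` configuration space; caged components must lie a gap above `E₀^per` — excluded at low density)
(refs: Reed–Simon IV XIII.12/47; Baryshnikov–Bubenik–Kahle 2013; LSSY 2005 §1.2). Stub statement — deliberately untagged. -/
def Sig.stub_positiveTransfer : Prop :=
  BECLiebAntibunching.PeriodicRigidity → BECCountConvexity.PositivePeriodicNearMinimiser →
  ∀ v : ℝ → ℝ≥0∞, IsRepulsiveFiniteRange v → ∃ ρr : ℝ, 0 < ρr ∧ ∀ ρ : ℝ, 0 < ρ → ρ < ρr →
    ∀ c₁ : ℝ, 0 < c₁ → ∀ᶠ N : ℕ in atTop, ∀ δ₁ : ℝ≥0∞, 0 < δ₁ →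
      (∀ Ψ : PeriodicTrialState N (sideLength ρ N), (∀ X, 0 ≤ (Ψ.ψ X).re ∧ (Ψ.ψ X).im = 0) →
        periodicEnergy v Ψ ≤ periodicGroundStateEnergy v N (sideLength ρ N) + δ₁ →
          ENNReal.ofReal (c₁ * N) ≤ condensateOccupation N (sideLength ρ N) Ψ.ψ) →
      ∃ δ : ℝ≥0∞, 0 < δ ∧ ∀ Ψ : PeriodicTrialState N (sideLength ρ N),
        periodicEnergy v Ψ ≤ periodicGroundStateEnergy v N (sideLength ρ N) + δ →
          ENNReal.ofReal (c₁ / 4 * N) ≤ condensateOccupation N (sideLength ρ N) Ψ.ψ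

/-! ## Sanity (proved): the trivial fixed-`M` instance of S5's inequality and the flat-kernel instance of S4's

Two finite-dimensional checks that the two open stubs are correctly normalised (they are the `v = 0` /
fixed-volume corners every triager probes first). -/

/-- Pointwise majorant behind "S5 is trivial at fixed `M`": for a non-negative field `r` on a finite index set,
`Σr³/R + ‖r‖⁴/R² ≤ 2‖r‖²` (`Σr³ ≤ R·‖r‖²` termwise and `‖r‖² ≤ R²`). [folklore] -/
theorem moment_le_two_mul_mass {ι : Type*} [Fintype ι] (r : ι → ℝ) (hr : ∀ x, 0 ≤ r x) :
    (∑ x, r x ^ 3) / (∑ x, r x) + (∑ x, r x ^ 2) ^ 2 / (∑ x, r x) ^ 2 ≤ 2 * ∑ x, r x ^ 2 := by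
  set R : ℝ := ∑ x, r x with hR
  set Q : ℝ := ∑ x, r x ^ 2 with hQ
  have hR0 : 0 ≤ R := Finset.sum_nonneg fun x _ => hr x
  have hQ0 : 0 ≤ Q := Finset.sum_nonneg fun x _ => by positivity
  have hle : ∀ x, r x ≤ R := fun x =>
    Finset.single_le_sum (f := r) (fun y _ => hr y) (Finset.mem_univ x)
  -- Σ r³ ≤ R Q
  have h3 : ∑ x, r x ^ 3 ≤ R * Q := by
    rw [hQ, Finset.mul_sum]
    refine Finset.sum_le_sum fun x _ => ?_
    have hx := hr x
    calc r x ^ 3 = r x * r x ^ 2 := by ring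
      _ ≤ R * r x ^ 2 := mul_le_mul_of_nonneg_right (hle x) (by positivity)
  -- Q ≤ R²
  have h2 : Q ≤ R ^ 2 := by
    rw [hQ, hR, sq, Finset.sum_mul_sum]
    refine Finset.sum_le_sum fun x _ => ?_
    rw [sq, ← Finset.mul_sum]
    exact mul_le_mul_of_nonneg_left (hle x) (hr x)
  by_cases hRz : R = 0
  · simp only [hRz, div_zero, zero_pow two_ne_zero, add_zero]
    positivity
  have hRpos : 0 < R := lt_of_le_of_ne hR0 (Ne.symm hRz)
  have t1 : (∑ x, r x ^ 3) / R ≤ Q := by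
    rw [div_le_iff₀ hRpos]; linarith [h3]
  have t2 : Q ^ 2 / R ^ 2 ≤ Q := by
    rw [div_le_iff₀ (by positivity)]
    nlinarith [h2, hQ0]
  linarith

/-- The flat kernel (`v = 0` exact minimiser: `K = k𝟙𝟙ᵀ`, `r = kn𝟙` on `n` cells) sits at `I_K = I_F/2`:
`‖K‖_F² = n²k²` while `Σr³/R + ‖r‖⁴/R² = 2n²k²` — the factor-2 slack of S4 at `a = 0` (Disproof §8a LESSON). [folklore] -/
theorem flatKernel_halfSlack (n : ℕ) (k : ℝ) (hn : 0 < n) (hk : 0 < k) :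
    let r : Fin n → ℝ := fun _ => ∑ _y : Fin n, k
    (∑ _x : Fin n, ∑ _y : Fin n, k ^ 2) * 2 =
      (∑ x, r x ^ 3) / (∑ x, r x) + (∑ x, r x ^ 2) ^ 2 / (∑ x, r x) ^ 2 := by
  intro r
  have hn' : (n : ℝ) ≠ 0 := by exact_mod_cast hn.ne'
  have hk' : k ≠ 0 := hk.ne'
  simp only [r, Finset.sum_const, Finset.card_univ, Fintype.card_fin, nsmul_eq_mul]
  field_simp
  ring

end Summit.AtomisticToContinuum.BoseEinsteinCondensation.Cruxes.LatticeToPeriodicBridge.CoarseCellLorentzian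

end
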